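import Mathlib
import Literature.NumberTheory.LFunctions.Zhang2022.Section15Step15u002
import Literature.NumberTheory.LFunctions.Zhang2022.Section16Step16u010
import HarnessLib

/-!
# Zhang (2022) §16 p. 88, `Z22:§16.u002`: "Similar to (15.3),
# `Φ₂ = Σ_{ψ∈Ψ₁}(p_ψt₀)^{β₁}(I₃⁺(ψ) − I₃⁻(ψ)) + O(ε)`" — kernel-checked

Topic `Literature/NumberTheory/LFunctions/Zhang2022` (Landau–Siegel audit tree; verdict-neutral).
Y. Zhang, *Discrete mean estimates and the Landau–Siegel zero*, arXiv:2211.02515v1 (2022)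
[Zhang2022LandauSiegel] — **an unrefereed manuscript under adjudication**; nothing here asserts or
denies its Theorems 1–2. DAG node `Z22:§16.u002` [Z22 p.88, tex L4404–L4408]:

> "Recall that `Φ₂` is given by (13.9). Write
> `𝒦₂(s,ψ) = Z(s,χψ)⁻¹ (L(s+β₁,ψ)/L(s,ψ)) B(s,ψ)N(s+β₃,ψ)K(1−s−β₂,ψ̄)` and
> `I₃^±(ψ) = (1/2πi)∫_{𝔍(±α)} 𝒦₂(s,ψ)ω(s) ds`. Similar to (15.3),
> `Φ₂ = Σ_{ψ∈Ψ₁}(p_ψt₀)^{β₁}(I₃⁺(ψ) − I₃⁻(ψ)) + O(ε)`."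

The typed node is `Typed.Section16A.Step16_u002 c′` (L4-t5). This file DISCHARGES it by instantiating
the tree's abstract (8.1) engine (`Section8aStatements.lratio_residue_edge_of_prop22`, file
`Section8ResidueEdgeEngine`) at `G₂(s) = Z(s,χψ)⁻¹B(s,ψ)N(s+β₃,ψ)K(1−s−β₂,ψ̄)` — holomorphic on
`{Im s > 0}` and `≤ A₂e^{5𝓛⁹}` on the boundary zone (`|Z(s,χψ)|⁻¹ ≤ e⁸`,
`Typed.Section15A.norm_inv_Zpc_le_exp8`; trivial bounds for `B`, `N`, `K`) — per `ψ ∈ Ψ₁`, and then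
summing over `#Ψ₁ ≤ 𝔓 ≤ 2P²` characters with `|(p_ψt₀)^{β₁}| = 1`, exactly as the tree's edge
`Typed.Section15A.eq15_3_of_u002` does for (15.3) (`Φ₂ = Σ_{ψ∈Ψ₁}(p_ψt₀)^{β₁}Σ_ρ 𝔨*₂(ρ,ψ)ω(ρ)`,
(13.9)).

Main results: `step16_u002_of_prop22 : 0 ≤ c′ → Skeleton.Prop22 c′ → Step16_u002 c′`,
`step16_u002_eventually` (from `Skeleton.prop22_eventually`), and — composing with the lane's bookkeeping
edge `Step16u010.step16_u010_of : Step16_u002 c′ → Step16_u004 c′ → Step16_u010 c′` — the leaf modulo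
its last displayed step: `step16_u010_of_u004_eventually : ∃ c₀ ≥ 0, ∀ c′ ≥ c₀, Step16_u004 c′ →
Step16_u010 c′`. No new definitions, no named facts. ZHANG-L discharge lane (strike seat
zl-closer-1), helper under leaf `Typed.Section16A.Step16_u010` of `Skeleton.theorem1_of_leaves_v19`.
WHAT THIS IS NOT: a proof of u004 (`I₃⁻(ψ) ≪ ε`), or any claim about (16.2)–(16.17), Theorems 1–2
of the source, or Landau–Siegel zeros.

## References

* Y. Zhang, arXiv:2211.02515v1 (2022), §16 p. 88 (tex L4404–L4408); §13 (13.5), (13.9) p. 74;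
  §8 (8.1) p. 42. [cite: Zhang2022LandauSiegel, §16 p. 88 (u002)]
-/

noncomputable section

open Complex Real Set

namespace Literature.NumberTheory.LFunctions.Zhang2022.Step16u010

open Literature.NumberTheory.LFunctions.Zhang2022 Skeleton
open Literature.NumberTheory.LFunctions.Zhang2022.Section8aStatements
open Literature.NumberTheory.LFunctions.Zhang2022.Typed.Section16A

/-! ### A. The numerator `G₂(s) = Z(s,χψ)⁻¹B(s,ψ)N(s+β₃,ψ)K(1−s−β₂,ψ̄)` -/

section GTwo

variable (c' : ℝ) {D : ℕ} [NeZero D] (χ : DirichletCharacter ℂ D) (x : Chr D)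

/-- `𝒦₂(s,ψ)ω(s) = (L(s+β₁,ψ)/L(s,ψ))·G₂(s)·ω(s)` (exact algebra of the display u001).
[cite: Zhang2022LandauSiegel, §16 p. 88, tex L4404] -/
theorem calK2_mul_omega_eq (s : ℂ) :
    calK2 c' χ x s * omegaW D s =
      x.ψ.LFunction (s + beta1 c' D) / x.ψ.LFunction s *
        ((Zpc χ x s)⁻¹ * Bpoly χ x s * Nchar D (psiFn x) (s + beta3 c' D) *
          Kchar D (psiBarFn x) (1 - s - beta2 c' D)) * omegaW D s := by
  simp only [calK2, div_eq_mul_inv]; ring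

/-- `𝔨*₂(ρ,ψ)ω(ρ) = (L(ρ+β₁,ψ)/L′(ρ,ψ))·G₂(ρ)·ω(ρ)` (exact algebra of (13.5)).
[cite: Zhang2022LandauSiegel, §13 (13.5) p. 74] -/
theorem kstar2_mul_omega_eq (ρ : ℂ) :
    kstar2 c' χ x ρ * omegaW D ρ =
      x.ψ.LFunction (ρ + beta1 c' D) / deriv x.ψ.LFunction ρ *
        ((Zpc χ x ρ)⁻¹ * Bpoly χ x ρ * Nchar D (psiFn x) (ρ + beta3 c' D) *
          Kchar D (psiBarFn x) (1 - ρ - beta2 c' D)) * omegaW D ρ := by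
  simp only [kstar2, div_eq_mul_inv]; ring

/-- `G₂` is holomorphic on the upper half-plane (`D ≥ 3`, `χ` primitive: `Z(·,χψ)` analytic and
zero-free on `{Im s > 0}`; `B`, `N`, `K` entire). [cite: Zhang2022LandauSiegel, §16 p. 88; §2 (2.5)] -/
theorem differentiableOn_G2 (hD : 3 ≤ D) (hχ : χ.IsPrimitive) :
    DifferentiableOn ℂ (fun s => (Zpc χ x s)⁻¹ * Bpoly χ x s * Nchar D (psiFn x) (s + beta3 c' D) *
      Kchar D (psiBarFn x) (1 - s - beta2 c' D)) {s : ℂ | 0 < s.im} := by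
  intro s hs
  have hprim := psiChiPrimitive_holds D χ x hD hχ
  have hZ : DifferentiableAt ℂ (fun s => (Zpc χ x s)⁻¹) s :=
    (GammaFactor.differentiableAt_Zfac (psiChi χ x) hs).inv (GammaFactor.Zfac_ne_zero hprim hs)
  have hB : DifferentiableAt ℂ (Bpoly χ x) s := Typed.Section17.differentiable_Bpoly χ x s
  have hN : DifferentiableAt ℂ (fun s => Nchar D (psiFn x) (s + beta3 c' D)) s :=
    ((Typed.Section17.differentiable_Nchar (psiFn x)).comp (differentiable_id.add_const _)) s
  have hK : DifferentiableAt ℂ (fun s => Kchar D (psiBarFn x) (1 - s - beta2 c' D)) s :=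
    ((differentiable_Kchar (psiBarFn x)).comp
      (((differentiable_const _).sub differentiable_id).sub_const _)) s
  exact (((hZ.mul hB).mul hN).mul hK).differentiableWithinAt

/-- **The size of `G₂` on the boundary zone**: for `D ≥ 3`, `χ` primitive, `𝓛 ≥ 80`, `ψ ∈ Ψ`, `|σ − ½| ≤ α`, `|t − 2πt₀| ≤ 𝓛₁ + 1`:
`|G₂(s)| ≤ e⁸·(1+|ι₂|)(|ι₃|+|ι₄|)(P+1)²·(P+1)·(2Pt₀+1) ≤ A₂e^{5𝓛⁹}`,
`A₂ = e⁸·4(1+|ι₂|)(|ι₃|+|ι₄|)·2·3`. [cite: Zhang2022LandauSiegel, §16 p. 88] -/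
theorem norm_G2_le (hD : 3 ≤ D) (hχ : χ.IsPrimitive) (h80 : 80 ≤ ell D) {s : ℂ}
    (hσ : |s.re - 1 / 2| ≤ alpha D) (ht : |s.im - 2 * π * t0 D| ≤ ell1 D + 1) :
    ‖(Zpc χ x s)⁻¹ * Bpoly χ x s * Nchar D (psiFn x) (s + beta3 c' D) *
        Kchar D (psiBarFn x) (1 - s - beta2 c' D)‖ ≤
      (Real.exp 8 * (4 * ((1 + ‖iota2‖) * (‖iota3‖ + ‖iota4‖))) * 2 * 3) *
        Real.exp (5 * ell D ^ 9) := by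
  have hL1 : 1 ≤ ell D := by linarith
  have hL2 : 2 ≤ Real.log D := by rw [← ell]; linarith
  have hL3 : 3 ≤ ell D := by linarith
  have hℓ0 : 0 < ell D := by linarith
  obtain ⟨-, -, hβ3⟩ := beta_eq_b_mul_I c' D
  obtain ⟨-, hβ2, -⟩ := beta_eq_b_mul_I c' D
  have hσ0 : 0 ≤ s.re := by
    have hα0 : alpha D ≤ 1 / 2 := by
      have := (Typed.Section17.alpha_sizes171 (C := 0) h80
        (by rw [abs_zero, mul_zero, zero_add]; exact hL1)).2.2.1
      linarith
    have := abs_le.mp hσ; linarith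
  set cB : ℝ := (1 + ‖iota2‖) * (‖iota3‖ + ‖iota4‖) with hcB
  have hcB0 : 0 ≤ cB := by positivity
  have hP : bigP D = Real.exp (ell D ^ 9) := rfl
  have hP0 : 0 < bigP D := Real.exp_pos _
  have hP1 : 1 ≤ bigP D := by rw [hP]; exact Real.one_le_exp (by positivity)
  -- the four factors
  have hZf : ‖(Zpc χ x s)⁻¹‖ ≤ Real.exp 8 :=
    Typed.Section15A.norm_inv_Zpc_le_exp8 hD hχ h80 x hσ ht
  have hBf : ‖Bpoly χ x s‖ ≤ cB * (bigP D + 1) ^ 2 :=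
    Typed.Section17.norm_Bpoly_le_trivial χ x hL2 hσ0
  have hNf : ‖Nchar D (psiFn x) (s + beta3 c' D)‖ ≤ bigP D + 1 := by
    refine Typed.Section17.norm_Nchar_le_trivial x hL3 ?_
    have : (s + beta3 c' D).re = s.re := by rw [hβ3]; simp
    rw [this]; exact hσ0
  have hKf : ‖Kchar D (psiBarFn x) (1 - s - beta2 c' D)‖ ≤ 2 * bigP D * t0 D + 1 := by
    refine Typed.Section15A.norm_Kchar_psiBar_le x hℓ0 ?_
    have : (1 - s - beta2 c' D).re = 1 - s.re := by rw [hβ2]; simp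
    rw [this]; have := abs_le.mp hσ
    have hα1 : alpha D ≤ 1 / 2 := by
      have := (Typed.Section17.alpha_sizes171 (C := 0) h80
        (by rw [abs_zero, mul_zero, zero_add]; exact hL1)).2.2.1
      linarith
    linarith
  -- exponential envelopes
  have hP2 : (bigP D + 1) ^ 2 ≤ 4 * Real.exp (2 * ell D ^ 9) := by
    calc (bigP D + 1) ^ 2 ≤ (2 * bigP D) ^ 2 := pow_le_pow_left₀ (by linarith) (by linarith) 2
      _ = 4 * Real.exp (2 * ell D ^ 9) := by rw [mul_pow, hP, ← Real.exp_nat_mul]; norm_num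
  have hP1' : bigP D + 1 ≤ 2 * Real.exp (ell D ^ 9) := by rw [hP] at hP1 ⊢; linarith
  have ht0e : t0 D ≤ Real.exp (ell D ^ 9) := by
    -- `t₀ = 𝓛⁵¹⁹ ≤ e^{519𝓛} ≤ e^{𝓛⁹}`
    have hLe : ell D ≤ Real.exp (ell D) := by linarith [Real.add_one_le_exp (ell D)]
    have h8 : (3 : ℝ) ^ 8 ≤ ell D ^ 8 := pow_le_pow_left₀ (by norm_num) hL3 8
    calc t0 D = ell D ^ 519 := rfl
      _ ≤ Real.exp (ell D) ^ 519 := pow_le_pow_left₀ hℓ0.le hLe 519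
      _ = Real.exp (519 * ell D) := by rw [← Real.exp_nat_mul]; norm_num
      _ ≤ Real.exp (ell D ^ 9) := by
          refine Real.exp_le_exp.mpr ?_
          have : ell D ^ 9 = ell D ^ 8 * ell D := by ring
          rw [this]; nlinarith
  have hK2 : 2 * bigP D * t0 D + 1 ≤ 3 * Real.exp (2 * ell D ^ 9) := by
    have h1 : bigP D * t0 D ≤ Real.exp (ell D ^ 9) * Real.exp (ell D ^ 9) := by
      rw [hP]; exact mul_le_mul_of_nonneg_left ht0e (Real.exp_pos _).le
    rw [← Real.exp_add, show ell D ^ 9 + ell D ^ 9 = 2 * ell D ^ 9 by ring] at h1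
    have h2 : (1 : ℝ) ≤ Real.exp (2 * ell D ^ 9) := Real.one_le_exp (by positivity)
    linarith
  have hBf' : ‖Bpoly χ x s‖ ≤ (4 * cB) * Real.exp (2 * ell D ^ 9) := by
    refine hBf.trans ?_
    calc cB * (bigP D + 1) ^ 2 ≤ cB * (4 * Real.exp (2 * ell D ^ 9)) :=
          mul_le_mul_of_nonneg_left hP2 hcB0
      _ = (4 * cB) * Real.exp (2 * ell D ^ 9) := by ring
  have hNf' := hNf.trans hP1'
  have hKf' := hKf.trans hK2
  rw [norm_mul, norm_mul, norm_mul]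
  calc ‖(Zpc χ x s)⁻¹‖ * ‖Bpoly χ x s‖ * ‖Nchar D (psiFn x) (s + beta3 c' D)‖ *
        ‖Kchar D (psiBarFn x) (1 - s - beta2 c' D)‖
      ≤ Real.exp 8 * ((4 * cB) * Real.exp (2 * ell D ^ 9)) * (2 * Real.exp (ell D ^ 9)) *
          (3 * Real.exp (2 * ell D ^ 9)) := by
        gcongr
    _ = (Real.exp 8 * (4 * cB) * 2 * 3) *
          (Real.exp (2 * ell D ^ 9) * Real.exp (ell D ^ 9) * Real.exp (2 * ell D ^ 9)) := by ring
    _ = (Real.exp 8 * (4 * cB) * 2 * 3) * Real.exp (5 * ell D ^ 9) := by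
        rw [← Real.exp_add, ← Real.exp_add]; ring_nf

end GTwo

/-! ### B. The per-character residue step, and `Z22:§16.u002` by summation over `Ψ₁` -/

set_option maxHeartbeats 400000 in
/-- **The §16 twin of `Z22:§15.u002`, per character**, from Proposition 2.2: for `c′ ≥ 0` with
`Skeleton.Prop22 c′` there is `C` such that for all large `D` and every `ψ ∈ Ψ₁`,
`‖Σ_{ρ∈𝔷(ψ)} 𝔨*₂(ρ,ψ)ω(ρ) − (I₃⁺(ψ) − I₃⁻(ψ))‖ ≤ C·e^{−𝓛¹⁰/8}` — the abstract (8.1) engine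
(`lratio_residue_edge_of_prop22`, growth exponent `κ = 6`) at `G = G₂` (`A₂e^{5𝓛⁹} ≤ e^{6𝓛⁹}` once
`𝓛 ≥ A₂`). [cite: Zhang2022LandauSiegel, §16 p. 88, tex L4408] -/
theorem sum_kstar2_sub_I3pm_le_of_prop22 {c' : ℝ} (hc' : 0 ≤ c') (h22 : Prop22 c') :
    ∃ C : ℝ, ForAllLarge fun D _ χ => AssumptionA D χ → ∀ x ∈ PsiOne χ,
      ‖(∑ ρ ∈ finsetOf (zeroSet D x), kstar2 c' χ x ρ * omegaW D ρ) -
          (I3pm c' χ x (alpha D) - I3pm c' χ x (-alpha D))‖ ≤ C * Real.exp (-(ell D ^ 10 / 8)) := by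
  obtain ⟨C', D₀, hC⟩ := lratio_residue_edge_of_prop22 hc' h22 6
  set A₂ : ℝ := Real.exp 8 * (4 * ((1 + ‖iota2‖) * (‖iota3‖ + ‖iota4‖))) * 2 * 3 with hA₂
  set L₀ : ℝ := max 80 A₂ with hL₀
  refine ⟨C', max D₀ (max 3 ⌈Real.exp L₀⌉₊), ?_⟩
  intro D _ χ hD hq hp hA x hx
  have hD₀ : D₀ ≤ D := le_trans (le_max_left _ _) hD
  have hD3 : 3 ≤ D := le_trans (le_max_left _ _) (le_trans (le_max_right _ _) hD)
  have hDℓ : ⌈Real.exp L₀⌉₊ ≤ D := le_trans (le_max_right _ _) (le_trans (le_max_right _ _) hD)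
  have hL : L₀ ≤ ell D := Section4.le_ell_of_ceil_exp_le hDℓ
  have h80 : 80 ≤ ell D := (le_max_left _ _).trans hL
  have hAL : A₂ ≤ ell D := (le_max_right _ _).trans hL
  have hL1 : 1 ≤ ell D := by linarith
  set G : ℂ → ℂ := fun s => (Zpc χ x s)⁻¹ * Bpoly χ x s * Nchar D (psiFn x) (s + beta3 c' D) *
    Kchar D (psiBarFn x) (1 - s - beta2 c' D) with hG
  have hGd : DifferentiableOn ℂ G {s : ℂ | 0 < s.im} := differentiableOn_G2 c' χ x hD3 hp
  have hA₂le : A₂ ≤ Real.exp (ell D ^ 9) := by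
    have h9 : ell D ≤ ell D ^ 9 := by
      calc ell D = ell D ^ 1 := (pow_one _).symm
        _ ≤ ell D ^ 9 := pow_le_pow_right₀ hL1 (by norm_num)
    have he : ell D ^ 9 ≤ Real.exp (ell D ^ 9) := by linarith [Real.add_one_le_exp (ell D ^ 9)]
    linarith
  have hGb : ∀ s : ℂ, |s.re - 1 / 2| ≤ alpha D → ell1 D - 1 ≤ |s.im - 2 * π * t0 D| →
      |s.im - 2 * π * t0 D| ≤ ell1 D + 1 / 4 → ‖G s‖ ≤ Real.exp (6 * ell D ^ 9) := by
    intro s hσ _ ht2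
    have h := norm_G2_le c' χ x hD3 hp h80 hσ (ht2.trans (by linarith))
    refine h.trans ?_
    calc A₂ * Real.exp (5 * ell D ^ 9) ≤ Real.exp (ell D ^ 9) * Real.exp (5 * ell D ^ 9) :=
          mul_le_mul_of_nonneg_right hA₂le (Real.exp_pos _).le
      _ = Real.exp (6 * ell D ^ 9) := by rw [← Real.exp_add]; ring_nf
  have key := hC D χ hD₀ hq hp hA x hx G hGd hGb
  have hsum : (∑ ρ ∈ finsetOf (zeroSet D x), kstar2 c' χ x ρ * omegaW D ρ) =
      ∑ ρ ∈ finsetOf (zeroSet D x),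
        x.ψ.LFunction (ρ + beta1 c' D) / deriv x.ψ.LFunction ρ * G ρ * omegaW D ρ :=
    Finset.sum_congr rfl fun ρ _ => kstar2_mul_omega_eq c' χ x ρ
  have hfun : (fun s => calK2 c' χ x s * omegaW D s) =
      fun s => x.ψ.LFunction (s + beta1 c' D) / x.ψ.LFunction s * G s * omegaW D s :=
    funext fun s => calK2_mul_omega_eq c' χ x s
  rw [hsum, I3pm, I3pm, hfun]
  exact key

set_option maxHeartbeats 400000 in
/-- **`Z22:§16.u002` DISCHARGED modulo Proposition 2.2**: for `c′ ≥ 0` with `Skeleton.Prop22 c′`,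
"`Φ₂ = Σ_{ψ∈Ψ₁}(p_ψt₀)^{β₁}(I₃⁺(ψ) − I₃⁻(ψ)) + O(ε)`" with `ε = e^{−𝓛¹⁰/16}`: `Φ₂ =
Σ_{ψ∈Ψ₁}(p_ψt₀)^{β₁}Σ_{ρ∈𝔷(ψ)}𝔨*₂(ρ,ψ)ω(ρ)` (13.9); per `ψ` the residue step costs `Ce^{−𝓛¹⁰/8}`
(`sum_kstar2_sub_I3pm_le_of_prop22`), `|(p_ψt₀)^{β₁}| = 1` (`norm_cpow_beta1`), and the
`#Ψ₁ ≤ 𝔓 ≤ 2P² = 2e^{2𝓛⁹}` copies are `≤ 2Ce^{−𝓛¹⁰/16}` once `𝓛 ≥ 32` (the summation of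
`Typed.Section15A.eq15_3_of_u002`). [cite: Zhang2022LandauSiegel, §16 p. 88 (u002), tex L4408] -/
theorem step16_u002_of_prop22 {c' : ℝ} (hc' : 0 ≤ c') (h22 : Prop22 c') : Step16_u002 c' := by
  classical
  obtain ⟨C, D₀, hD₀⟩ := sum_kstar2_sub_I3pm_le_of_prop22 hc' h22
  obtain ⟨D₁, hD₁⟩ := Typed.Section15A.frakP_le_two_mul_bigP_sq
  refine ⟨1 / 16, by norm_num, 2 * max C 0, max D₀ (max D₁ ⌈Real.exp 32⌉₊),
    fun D _ χ hD hq hp hA => ?_⟩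
  have hb := hD₀ D χ (le_trans (le_max_left _ _) hD) hq hp hA
  have hfrakP := hD₁ D (le_trans (le_trans (le_max_left _ _) (le_max_right _ _)) hD)
  have hℓ : (32 : ℝ) ≤ ell D :=
    Section4.le_ell_of_ceil_exp_le (le_trans (le_trans (le_max_right _ _) (le_max_right _ _)) hD)
  have hℓ0 : 0 < ell D := by linarith
  have ht0 : 0 < t0 D := by rw [t0]; positivity
  set E : ℝ := Real.exp (-(ell D ^ 10 / 8)) with hE
  have hE0 : 0 < E := Real.exp_pos _
  have hC : C ≤ max C 0 := le_max_left _ _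
  have hC0 : 0 ≤ max C 0 := le_max_right _ _
  have hPhi : Phi2 c' χ = ∑ x ∈ finsetOf (PsiOne χ), (((x.p : ℝ) * t0 D : ℝ) : ℂ) ^ beta1 c' D *
      ∑ ρ ∈ finsetOf (zeroSet D x), kstar2 c' χ x ρ * omegaW D ρ := by
    rw [Phi2, idx, Finset.sum_sigma]
    refine Finset.sum_congr rfl fun x _ => ?_
    rw [Finset.mul_sum]
    refine Finset.sum_congr rfl fun ρ _ => ?_
    ring
  rw [hPhi, ← Finset.sum_sub_distrib]
  -- the count: `#Ψ₁ · ε ≤ 𝔓 ε ≤ 2P² ε ≤ 2 e^{−𝓛¹⁰/16}`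
  have hcount : ((finsetOf (PsiOne χ)).card : ℝ) * (max C 0 * E) ≤
      2 * max C 0 * Real.exp (-(1 / 16) * ell D ^ 10) := by
    have h1 : ((finsetOf (PsiOne χ)).card : ℝ) ≤ 2 * bigP D ^ 2 :=
      le_trans (Ded81Edge.card_finsetOf_psiOne_le_frakP χ) hfrakP
    have h2 : bigP D ^ 2 * E ≤ Real.exp (-(1 / 16) * ell D ^ 10) := by
      rw [hE, bigP, ← Real.exp_nat_mul, ← Real.exp_add, Real.exp_le_exp]
      have h9 : 0 < ell D ^ 9 := by positivity
      have : (2 : ℝ) * ell D ^ 9 ≤ (1 / 16) * ell D ^ 10 := by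
        have : (1 / 16 : ℝ) * ell D ^ 10 = (ell D / 16) * ell D ^ 9 := by ring
        rw [this]
        exact mul_le_mul_of_nonneg_right (by linarith) h9.le
      push_cast
      nlinarith
    calc ((finsetOf (PsiOne χ)).card : ℝ) * (max C 0 * E)
        ≤ 2 * bigP D ^ 2 * (max C 0 * E) := mul_le_mul_of_nonneg_right h1 (by positivity)
      _ = 2 * max C 0 * (bigP D ^ 2 * E) := by ring
      _ ≤ 2 * max C 0 * Real.exp (-(1 / 16) * ell D ^ 10) :=
          mul_le_mul_of_nonneg_left h2 (by positivity)
  calc ‖∑ x ∈ finsetOf (PsiOne χ), ((((x.p : ℝ) * t0 D : ℝ) : ℂ) ^ beta1 c' D *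
            ∑ ρ ∈ finsetOf (zeroSet D x), kstar2 c' χ x ρ * omegaW D ρ -
          (((x.p : ℝ) * t0 D : ℝ) : ℂ) ^ beta1 c' D * (I3pm c' χ x (alpha D) - I3pm c' χ x (-alpha D)))‖
      ≤ ∑ x ∈ finsetOf (PsiOne χ), ‖(((x.p : ℝ) * t0 D : ℝ) : ℂ) ^ beta1 c' D *
            ∑ ρ ∈ finsetOf (zeroSet D x), kstar2 c' χ x ρ * omegaW D ρ -
          (((x.p : ℝ) * t0 D : ℝ) : ℂ) ^ beta1 c' D * (I3pm c' χ x (alpha D) - I3pm c' χ x (-alpha D))‖ :=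
        norm_sum_le _ _
    _ ≤ ∑ x ∈ finsetOf (PsiOne χ), max C 0 * E := Finset.sum_le_sum fun x hx => by
        rw [← mul_sub, norm_mul, norm_cpow_beta1 c' x ht0, one_mul]
        exact le_trans (hb x (mem_of_mem_finsetOf hx)) (mul_le_mul_of_nonneg_right hC hE0.le)
    _ = ((finsetOf (PsiOne χ)).card : ℝ) * (max C 0 * E) := by
        rw [Finset.sum_const, nsmul_eq_mul]
    _ ≤ 2 * max C 0 * Real.exp (-(1 / 16) * ell D ^ 10) := hcount

/-- **`Z22:§16.u002` holds for every `c′ ≥ c₀`** (Proposition 2.2 is a tree theorem eventually in `c′`,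
`Skeleton.prop22_eventually`). [cite: Zhang2022LandauSiegel, §16 p. 88 (u002)] -/
theorem step16_u002_eventually : ∃ c₀ : ℝ, 0 ≤ c₀ ∧ ∀ c' : ℝ, c₀ ≤ c' → Step16_u002 c' := by
  obtain ⟨c₀, hc₀, h⟩ := prop22_eventually
  exact ⟨c₀, hc₀, fun c' hc' => step16_u002_of_prop22 (hc₀.trans hc') (h c' hc')⟩

/-- **The leaf `Z22:§16.u010` modulo its last displayed step u004** (`I₃⁻(ψ) ≪ ε`): for every
`c′ ≥ c₀`, `Step16_u004 c′ → Step16_u010 c′` — composing `step16_u002_eventually` with the lane's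
bookkeeping edge `step16_u010_of` (u005 from u002 + u004; the move `𝔍(α) → 𝔍(1)` and the rewriting as
`Θ₂(β₁,𝐤₂*,𝐚₂*)`, all tree theorems). [cite: Zhang2022LandauSiegel, §16 p. 89 (u010), tex L4445] -/
theorem step16_u010_of_u004_eventually :
    ∃ c₀ : ℝ, 0 ≤ c₀ ∧ ∀ c' : ℝ, c₀ ≤ c' → Step16_u004 c' → Step16_u010 c' := by
  obtain ⟨c₀, hc₀, h⟩ := step16_u002_eventually
  exact ⟨c₀, hc₀, fun c' hc' h4 => step16_u010_of c' (h c' hc') h4⟩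

end Literature.NumberTheory.LFunctions.Zhang2022.Step16u010
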